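import Mathlib

/-!
# Doeblin's minorisation theorem: a uniform minorisation gives geometric convergence, setwise

Meyn, S. P. and Tweedie, R. L., *Markov Chains and Stochastic Stability* (Springer 1993)
[MeynTweedie1993], Theorem 16.2.4 (with Theorem 16.0.2): if a Markov kernel `K` on a general measurable
space satisfies DOEBLIN's condition `K(x, ·) ≥ ε ν(·)` for all states `x`, some probability measure `ν` and
some `ε > 0` (the whole space is *small*), then the chain is uniformly ergodic:
`sup_A |Kᵗ(x, A) - π(A)| ≤ (1 - ε)ᵗ`.  (Doeblin 1938; the constant here is the sharp one of the
regeneration / split-chain argument.)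

This file is OUR formalisation of that published theorem, in the elementary "residual kernel" form which
needs no coupling and no Hahn decomposition: with the residual Markov kernel
`R(x, ·) = (K(x, ·) - ε ν)/(1 - ε)` one has the exact expansion, for every probability law `μ`,
`μ Kᵗ = γ_t + (1 - ε)ᵗ · μ Rᵗ` with `γ_t` INDEPENDENT of `μ` (`exists_iterate_bind_eq`); hence for two
initial laws `|μKᵗ(A) - μ'Kᵗ(A)| ≤ (1 - ε)ᵗ` for every measurable `A` (`doeblin_iterate_sub_le`), and
against an invariant probability law `π`, `|μKᵗ(A) - π(A)| ≤ (1 - ε)ᵗ` (`doeblin_iterate_sub_invariant_le`).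
Stated over Mathlib's `ProbabilityTheory.Kernel`, `Measure.bind`, `Kernel.Invariant`.

Used by the pub-lqcd venture (`Summits/Ventures/LatticeQCDFlow/Exactness/`): the flow-MCMC (independence
Metropolis) kernel of an approximately trivializing flow satisfies Doeblin with `ε = e^{-2δ}`.
-/

noncomputable section

open MeasureTheory ProbabilityTheory
open scoped ENNReal

namespace Literature.Probability.MarkovChains

variable {Ω : Type*} [MeasurableSpace Ω]

namespace Doeblin

/-! ### The residual kernel -/

/-- `bind` is additive in the measure (setwise: `∫ K(x,A) d(μ + μ') = ∫ … dμ + ∫ … dμ'`). [folklore] -/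
private theorem bind_add' (μ μ' : Measure Ω) (κ : Kernel Ω Ω) :
    (μ + μ').bind κ = μ.bind κ + μ'.bind κ := by
  ext A hA
  rw [Measure.bind_apply hA (Kernel.aemeasurable κ), Measure.add_apply,
    Measure.bind_apply hA (Kernel.aemeasurable κ), Measure.bind_apply hA (Kernel.aemeasurable κ),
    lintegral_add_measure]

/-- The residual measure `K(x, ·) - ε ν` at a state, under the minorisation. [folklore] -/
private theorem sub_apply' {κ : Kernel Ω Ω} [IsMarkovKernel κ] {ν : Measure Ω} [IsProbabilityMeasure ν]
    {ε : ℝ≥0∞}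
    (hmin : ∀ x {B : Set Ω}, MeasurableSet B → ε * ν B ≤ κ x B) (x : Ω) {A : Set Ω}
    (hA : MeasurableSet A) : (κ x - ε • ν) A = κ x A - ε * ν A := by
  haveI : IsFiniteMeasure (ε • ν) := by
    refine ⟨?_⟩
    rw [Measure.smul_apply, smul_eq_mul]
    exact ((hmin x MeasurableSet.univ).trans_lt (measure_lt_top _ _))
  rw [Measure.sub_apply hA (Measure.le_iff.2 fun B hB => by
    rw [Measure.smul_apply, smul_eq_mul]; exact hmin x hB), Measure.smul_apply, smul_eq_mul]

/-- **The residual kernel** `R(x, ·) = (1 - ε)⁻¹ · (K(x, ·) - ε ν)` of a kernel minorised by `ε ν`.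
[cite: MeynTweedie1993, Thm 16.2.4 (proof; the split / residual kernel of §5.1)] -/
def residualKernel (κ : Kernel Ω Ω) [IsMarkovKernel κ] (ν : Measure Ω) [IsProbabilityMeasure ν] (ε : ℝ≥0∞)
    (hmin : ∀ x {B : Set Ω}, MeasurableSet B → ε * ν B ≤ κ x B) : Kernel Ω Ω where
  toFun x := (1 - ε)⁻¹ • (κ x - ε • ν)
  measurable' := by
    refine Measure.measurable_of_measurable_coe _ fun A hA => ?_
    have h : (fun x => ((1 - ε)⁻¹ • (κ x - ε • ν)) A) = fun x => (1 - ε)⁻¹ * (κ x A - ε * ν A) := by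
      funext x
      rw [Measure.smul_apply, smul_eq_mul, sub_apply' hmin x hA]
    rw [h]
    exact ((Kernel.measurable_coe κ hA).sub measurable_const).const_mul _

variable {κ : Kernel Ω Ω} [IsMarkovKernel κ] {ν : Measure Ω} [IsProbabilityMeasure ν] {ε : ℝ≥0∞}
  {hmin : ∀ x {B : Set Ω}, MeasurableSet B → ε * ν B ≤ κ x B}

/-- Setwise formula for the residual kernel. [cite: MeynTweedie1993, Thm 16.2.4 (proof)] -/
theorem residualKernel_apply (x : Ω) {A : Set Ω} (hA : MeasurableSet A) :
    residualKernel κ ν ε hmin x A = (1 - ε)⁻¹ * (κ x A - ε * ν A) := by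
  show ((1 - ε)⁻¹ • (κ x - ε • ν)) A = _
  rw [Measure.smul_apply, smul_eq_mul, sub_apply' hmin x hA]

/-- **Splitting of the kernel**: `K(x, A) = ε ν(A) + (1 - ε) R(x, A)` (for `ε < 1`).
[cite: MeynTweedie1993, Thm 16.2.4 (proof), eq. (5.2)–(5.3)] -/
theorem apply_eq_add_residual (hε : ε < 1) (x : Ω) {A : Set Ω} (hA : MeasurableSet A) :
    κ x A = ε * ν A + (1 - ε) * residualKernel κ ν ε hmin x A := by
  have h1 : 1 - ε ≠ 0 := (tsub_pos_of_lt hε).ne'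
  have h2 : 1 - ε ≠ ⊤ := ne_top_of_le_ne_top ENNReal.one_ne_top tsub_le_self
  rw [residualKernel_apply x hA, ← mul_assoc, ENNReal.mul_inv_cancel h1 h2, one_mul,
    add_tsub_cancel_of_le (hmin x hA)]

/-- The residual kernel is Markov when `K` is (and `ε < 1`). [cite: MeynTweedie1993, Thm 16.2.4 (proof)] -/
theorem isMarkovKernel_residualKernel (hε : ε < 1) :
    IsMarkovKernel (residualKernel κ ν ε hmin) := by
  have h1 : 1 - ε ≠ 0 := (tsub_pos_of_lt hε).ne'
  have h2 : 1 - ε ≠ ⊤ := ne_top_of_le_ne_top ENNReal.one_ne_top tsub_le_self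
  refine ⟨fun x => ⟨?_⟩⟩
  rw [residualKernel_apply x MeasurableSet.univ, measure_univ, measure_univ, mul_one,
    ENNReal.inv_mul_cancel h1 h2]

/-- **One step of the chain splits**: for a probability law `μ`, `μK = ε ν + (1 - ε) μR`.
[cite: MeynTweedie1993, Thm 16.2.4 (proof)] -/
theorem bind_eq_add_residual (hε : ε < 1) (μ : Measure Ω) [IsProbabilityMeasure μ] :
    μ.bind κ = ε • ν + (1 - ε) • μ.bind (residualKernel κ ν ε hmin) := by
  ext A hA
  rw [Measure.bind_apply hA (Kernel.aemeasurable κ), Measure.add_apply, Measure.smul_apply,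
    Measure.smul_apply, smul_eq_mul, smul_eq_mul, Measure.bind_apply hA (Kernel.aemeasurable _)]
  have h : (fun x => κ x A) = fun x => ε * ν A + (1 - ε) * residualKernel κ ν ε hmin x A :=
    funext fun x => apply_eq_add_residual hε x hA
  rw [h, lintegral_add_left measurable_const, lintegral_const, measure_univ, mul_one,
    lintegral_const_mul _ (Kernel.measurable_coe _ hA)]

/-- **The exact expansion of the iterates**: there is a measure `γ_t`, independent of the initial law, with
`μ Kᵗ = γ_t + (1 - ε)ᵗ · μ Rᵗ` for EVERY probability law `μ`
(`γ_t = ∑_{s<t} ε (1-ε)ˢ ν Rˢ`, not needed explicitly). [cite: MeynTweedie1993, Thm 16.2.4 (proof)] -/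
theorem exists_iterate_bind_eq (hε : ε < 1) (t : ℕ) :
    ∃ γ : Measure Ω, ∀ (μ : Measure Ω) [IsProbabilityMeasure μ],
      (fun m : Measure Ω => m.bind κ)^[t] μ =
        γ + (1 - ε) ^ t • (fun m : Measure Ω => m.bind (residualKernel κ ν ε hmin))^[t] μ := by
  haveI := isMarkovKernel_residualKernel (κ := κ) (ν := ν) (hmin := hmin) hε
  induction t with
  | zero => exact ⟨0, fun μ _ => by simp⟩
  | succ t ih =>
    obtain ⟨γ, hγ⟩ := ih
    refine ⟨γ.bind κ + ((1 - ε) ^ t * ε) • ν, fun μ _ => ?_⟩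
    -- the `t`-fold residual iterate of a probability law is a probability law
    have hprob : ∀ (s : ℕ) (m : Measure Ω) [IsProbabilityMeasure m],
        IsProbabilityMeasure ((fun m : Measure Ω => m.bind (residualKernel κ ν ε hmin))^[s] m) := by
      intro s
      induction s with
      | zero => intro m hm; simpa using hm
      | succ s ihs =>
        intro m hm
        rw [Function.iterate_succ_apply']
        haveI := ihs m
        exact ⟨by rw [Measure.bind_apply MeasurableSet.univ (Kernel.aemeasurable _)]; simp⟩
    haveI := hprob t μ
    rw [Function.iterate_succ_apply', hγ μ, bind_add', Measure.bind_smul,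
      bind_eq_add_residual (hmin := hmin) hε ((fun m : Measure Ω =>
        m.bind (residualKernel κ ν ε hmin))^[t] μ),
      Function.iterate_succ_apply', smul_add, smul_smul, smul_smul, ← pow_succ, add_assoc]

/-- **Doeblin's theorem, two initial laws**: under `K(x, ·) ≥ ε ν(·)` (`ε ≤ 1`), for all probability laws
`μ, μ'`, all `t` and every set `A` (measurable or not: outer measure): `|μKᵗ(A) - μ'Kᵗ(A)| ≤ (1 - ε)ᵗ`.
[cite: MeynTweedie1993, Thm 16.2.4] -/
theorem doeblin_iterate_sub_le (hmin : ∀ x {B : Set Ω}, MeasurableSet B → ε * ν B ≤ κ x B)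
    (hε1 : ε ≤ 1) (μ μ' : Measure Ω) [IsProbabilityMeasure μ] [IsProbabilityMeasure μ'] (t : ℕ)
    (A : Set Ω) :
    |((fun m : Measure Ω => m.bind κ)^[t] μ).real A - ((fun m : Measure Ω => m.bind κ)^[t] μ').real A|
      ≤ (1 - ε.toReal) ^ t := by
  -- iterates of a Markov kernel send probability laws to probability laws
  have hprobK : ∀ (s : ℕ) (m : Measure Ω) [IsProbabilityMeasure m],
      IsProbabilityMeasure ((fun m : Measure Ω => m.bind κ)^[s] m) := by
    intro s
    induction s with
    | zero => intro m hm; simpa using hm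
    | succ s ihs =>
      intro m hm
      rw [Function.iterate_succ_apply']
      haveI := ihs m
      exact ⟨by rw [Measure.bind_apply MeasurableSet.univ (Kernel.aemeasurable _)]; simp⟩
  rcases eq_or_lt_of_le hε1 with h1 | hε
  · -- `ε = 1`: then `K(x, ·) = ν` for every `x`, and both iterates coincide for `t ≥ 1`
    subst h1
    have hKν : ∀ (x : Ω) {B : Set Ω}, MeasurableSet B → κ x B = ν B := fun x B hB => by
      refine le_antisymm ?_ (by simpa using hmin x hB)
      have hc : ν Bᶜ ≤ κ x Bᶜ := by simpa using hmin x hB.compl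
      rw [prob_compl_eq_one_sub hB, prob_compl_eq_one_sub hB] at hc
      exact (ENNReal.sub_le_sub_iff_left prob_le_one ENNReal.one_ne_top).1 hc
    have hstep : ∀ (m : Measure Ω) [IsProbabilityMeasure m], m.bind κ = ν := fun m _ => by
      ext B hB
      rw [Measure.bind_apply hB (Kernel.aemeasurable κ)]
      simp_rw [hKν _ hB]
      rw [lintegral_const, measure_univ, mul_one]
    cases t with
    | zero =>
      simp only [Function.iterate_zero, id_eq, pow_zero]
      have h0 := measureReal_nonneg (μ := μ) (s := A)
      have h0' := measureReal_nonneg (μ := μ') (s := A)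
      have h1 := measureReal_le_one (μ := μ) (s := A)
      have h1' := measureReal_le_one (μ := μ') (s := A)
      rw [abs_le]
      constructor <;> linarith
    | succ t =>
      have hfixν : (fun m : Measure Ω => m.bind κ)^[t] ν = ν :=
        Function.iterate_fixed (f := fun m : Measure Ω => m.bind κ) (hstep ν) t
      rw [Function.iterate_succ_apply, Function.iterate_succ_apply, hstep μ, hstep μ', hfixν, sub_self,
        abs_zero]
      simp
  -- `ε < 1`: the exact expansion
  obtain ⟨γ, hγ⟩ := exists_iterate_bind_eq (κ := κ) (ν := ν) (hmin := hmin) hε t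
  haveI := isMarkovKernel_residualKernel (κ := κ) (ν := ν) (hmin := hmin) hε
  have hprobR : ∀ (s : ℕ) (m : Measure Ω) [IsProbabilityMeasure m],
      IsProbabilityMeasure ((fun m : Measure Ω => m.bind (residualKernel κ ν ε hmin))^[s] m) := by
    intro s
    induction s with
    | zero => intro m hm; simpa using hm
    | succ s ihs =>
      intro m hm
      rw [Function.iterate_succ_apply']
      haveI := ihs m
      exact ⟨by rw [Measure.bind_apply MeasurableSet.univ (Kernel.aemeasurable _)]; simp⟩
  set c : ℝ≥0∞ := (1 - ε) ^ t with hc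
  have hctop : c ≠ ⊤ := ENNReal.pow_ne_top (ne_top_of_le_ne_top ENNReal.one_ne_top tsub_le_self)
  have hcreal : c.toReal = (1 - ε.toReal) ^ t := by
    rw [hc, ENNReal.toReal_pow, ENNReal.toReal_sub_of_le hε1 ENNReal.one_ne_top, ENNReal.toReal_one]
  -- the two iterates, expanded
  set a := ((fun m : Measure Ω => m.bind (residualKernel κ ν ε hmin))^[t] μ) A with ha
  set a' := ((fun m : Measure Ω => m.bind (residualKernel κ ν ε hmin))^[t] μ') A with ha'
  have ha1 : a ≤ 1 := by haveI := hprobR t μ; exact prob_le_one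
  have ha1' : a' ≤ 1 := by haveI := hprobR t μ'; exact prob_le_one
  have hγtop : γ A ≠ ⊤ := by
    haveI := hprobK t μ
    have h : γ A ≤ ((fun m : Measure Ω => m.bind κ)^[t] μ) A := by
      rw [hγ μ, Measure.add_apply]; exact le_self_add
    exact ne_top_of_le_ne_top (measure_ne_top _ _) h
  have hμt : ((fun m : Measure Ω => m.bind κ)^[t] μ).real A = (γ A).toReal + c.toReal * a.toReal := by
    rw [measureReal_def, hγ μ, Measure.add_apply, Measure.smul_apply, smul_eq_mul,
      ENNReal.toReal_add hγtop (ENNReal.mul_ne_top hctop (ne_top_of_le_ne_top ENNReal.one_ne_top ha1)),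
      ENNReal.toReal_mul]
  have hμ't : ((fun m : Measure Ω => m.bind κ)^[t] μ').real A = (γ A).toReal + c.toReal * a'.toReal := by
    rw [measureReal_def, hγ μ', Measure.add_apply, Measure.smul_apply, smul_eq_mul,
      ENNReal.toReal_add hγtop (ENNReal.mul_ne_top hctop (ne_top_of_le_ne_top ENNReal.one_ne_top ha1')),
      ENNReal.toReal_mul]
  rw [hμt, hμ't, hcreal]
  have hb : |a.toReal - a'.toReal| ≤ 1 := by
    have h0 : 0 ≤ a.toReal := ENNReal.toReal_nonneg
    have h0' : 0 ≤ a'.toReal := ENNReal.toReal_nonneg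
    have h1 : a.toReal ≤ 1 := ENNReal.toReal_le_of_le_ofReal zero_le_one (by simpa using ha1)
    have h1' : a'.toReal ≤ 1 := ENNReal.toReal_le_of_le_ofReal zero_le_one (by simpa using ha1')
    rw [abs_le]; constructor <;> linarith
  have hcnn : 0 ≤ (1 - ε.toReal) ^ t := by rw [← hcreal]; exact ENNReal.toReal_nonneg
  calc |(γ A).toReal + (1 - ε.toReal) ^ t * a.toReal - ((γ A).toReal + (1 - ε.toReal) ^ t * a'.toReal)|
      = (1 - ε.toReal) ^ t * |a.toReal - a'.toReal| := by
        rw [show (γ A).toReal + (1 - ε.toReal) ^ t * a.toReal -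
            ((γ A).toReal + (1 - ε.toReal) ^ t * a'.toReal) =
            (1 - ε.toReal) ^ t * (a.toReal - a'.toReal) by ring, abs_mul, abs_of_nonneg hcnn]
    _ ≤ (1 - ε.toReal) ^ t * 1 := mul_le_mul_of_nonneg_left hb hcnn
    _ = (1 - ε.toReal) ^ t := mul_one _

/-- **Doeblin's theorem (uniform ergodicity, setwise)**: if `K(x, ·) ≥ ε ν(·)` for all `x` (`ε ≤ 1`, `ν` a
probability measure) and `π` is an invariant probability law of `K`, then for every initial probability law
`μ`, every `t` and every set `A`: `|μKᵗ(A) - π(A)| ≤ (1 - ε)ᵗ`. [cite: MeynTweedie1993, Thm 16.2.4] -/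
theorem doeblin_iterate_sub_invariant_le
    (hmin : ∀ x {B : Set Ω}, MeasurableSet B → ε * ν B ≤ κ x B) (hε1 : ε ≤ 1)
    {π : Measure Ω} [IsProbabilityMeasure π] (hπ : Kernel.Invariant κ π)
    (μ : Measure Ω) [IsProbabilityMeasure μ] (t : ℕ) (A : Set Ω) :
    |((fun m : Measure Ω => m.bind κ)^[t] μ).real A - π.real A| ≤ (1 - ε.toReal) ^ t := by
  have hfix : (fun m : Measure Ω => m.bind κ)^[t] π = π :=
    Function.iterate_fixed (f := fun m : Measure Ω => m.bind κ) hπ.def t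
  have h := doeblin_iterate_sub_le hmin hε1 μ π t A
  rwa [hfix] at h

end Doeblin

end Literature.Probability.MarkovChains
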